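import Literature.NumberTheory.Automorphic.UpqGlobalizationTorusLaw
import Literature.NumberTheory.Automorphic.UpqGlobalizationTorusLawDeriv
import Literature.RepresentationTheory.KonnoKonno2007.U21KAKSectionAlongTorus
import Literature.NumberTheory.Automorphic.UpqGlobOpHypotheses
import HarnessLib

/-!
# The torus translation law `Φ(g · a_s) = Φ(g) ∘ U₀(s)` for `U(2,1)`

[cite: HarishChandra1953, §9] (the one-parameter groups generated by the analytic vectors of an irreducible quasi-simple representation and their
uniqueness); [cite: Knapp2002, Thm. 7.39] (the `KAK` decomposition).

For the real unitary group `U(2,1) = uFormGroup (Fin 2) (Fin 1)` (`p₀ = 0`, `q₀ = 0`, `H₀ = upqUnit (0,0) (−I)`, `a_s = hypV 0 0 s = exp (s H₀)`) and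
`(𝔤, K)`-module data `(ρK, ρ)` on `V` carrying a positive-definite `K`-invariant `ρ`-skew hermitian form `B` with the factorial bound `(FB)` at `K > 0`,
the descended operator field `Φ = globOp 0 0 (hB.kRep ρK) (hB.U ρ K H₀)` of ★ `RealUnitaryRankOneKAKDescent` satisfies the **torus translation law**

  `Φ (g · a_s) = Φ (g) ∘ U₀(s)`   for every `g ∈ U(2,1)` and `s ∈ ℝ`.

Proof = the three ★ pieces assembled: ★ Φ2-core `eq_comp_U_of_hasDerivAt_inner` (an operator identity from its differentiated weak form, by the
Taylor∕factorial-bound uniqueness engine and continuity through the `≤ 1` point where `g a_s ∈ K`), whose derivative hypothesis `hder` at every `s₀` with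
`g a_{s₀} ∉ K` is ★ Φ2-diff `hasDerivAt_inner_globOp_mul_hypV` (differentiation of `Φ = ϖK(k₁) U₀(τ) ϖK(k₂)` along a `KAK` section, closed by the weak
`Ad`-identity and the Cartan relation `(E1)`), fed by ★ Φ2-geom `exists_section_along_hypV` (a differentiable `KAK` section of `s ↦ g a_s` near `s₀` on
`U(2,1)` together with `(E1)`); the `globOp` hypotheses `hU0 hM hW` are ★ Φ3-a (`UpqGlobOpHypotheses`).  This is hypothesis `htorus` of `UpqUnitaryGlobalization`
(`globOp_mul`, `isUnitaryGlobalization_globRep`) at `(Fin 2, Fin 1)`.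

Statement in the tree's vocabulary — theorems only; no instance, no notation, no named fact, no `sorry`.  Cell `hodgecm-mathlib`, ROAD-GLOB v1.1 (A6 #92),
T1a LEAD F0P3b-p01 (g3).
-/

noncomputable section

open Finset Set Filter Complex
open scoped Nat InnerProductSpace ComplexConjugate Matrix.Norms.Operator Topology MatrixGroups
open Literature.RepresentationTheory.KonnoKonno2007 Literature.RepresentationTheory.KonnoKonno2007.RealDualPair
open Literature.RepresentationTheory.KonnoKonno2007.RealDualPair.UForm Literature.RepresentationTheory.BorelWallach2000

attribute [local instance 100] LieRing.ofAssociativeRing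

namespace Literature.NumberTheory.Automorphic

namespace IsPosDefHerm

variable {V : Type*} [AddCommGroup V] [Module ℂ V] {B : V →ₗ⋆[ℂ] V →ₗ[ℂ] ℂ} (hB : IsPosDefHerm B)

include hB

/-- **Torus translation law on `U(2,1)`**: `Φ (g · a_s) = Φ (g) ∘ U₀(s)` for the descended operator field `Φ = globOp 0 0 (hB.kRep ρK) (hB.U ρ K H₀)` of
`(𝔤, K)`-module data with a `K`-invariant, `ρ`-skew, positive-definite hermitian form satisfying `(FB)` at `K > 0` (★ Φ2-core + ★ Φ2-diff + ★ Φ2-geom, `globOp`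
hypotheses by ★ Φ3-a).
[cite: HarishChandra1953, §9] [cite: Knapp2002, Thm. 7.39] -/
theorem globOp_mul_hypV_uTwoOne
    {ρK : Representation ℂ (uFormGroup (Fin 2) (Fin 1)).maximalCompact V} {ρ : (uFormGroup (Fin 2) (Fin 1)).lie →ₗ⁅ℝ⁆ Module.End ℂ V}
    (hV : IsGKModule (uFormGroup (Fin 2) (Fin 1)) ρK ρ)
    (hinv : ∀ (k : (uFormGroup (Fin 2) (Fin 1)).maximalCompact) (x y : V), B (ρK k x) (ρK k y) = B x y) {K : ℝ} (hK : 0 < K)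
    (hskew : ∀ (X : (uFormGroup (Fin 2) (Fin 1)).lie) (x y : V), B (ρ X x) y = -B x (ρ X y))
    (hFB : ∀ v : V, ∃ C : ℝ, ∀ (m : ℕ) (X : Fin m → (uFormGroup (Fin 2) (Fin 1)).lie),
      ‖hB.emb ((List.ofFn fun i => (ρ (X i) : V →ₗ[ℂ] V)).prod v)‖ ≤
        C * m ! * K ^ m * ∏ i, ‖((X i : (uFormGroup (Fin 2) (Fin 1)).lie) : Matrix (Fin 2 ⊕ Fin 1) (Fin 2 ⊕ Fin 1) ℂ)‖)
    (g : UForm (Fin 2) (Fin 1)) (s : ℝ) :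
    globOp (0 : Fin 2) (0 : Fin 1) (hB.kRep ρK hinv) (hB.U ρ K (upqUnit ((0 : Fin 2), (0 : Fin 1)) (-I))) (g * hypV (0 : Fin 2) (0 : Fin 1) s) =
      globOp (0 : Fin 2) (0 : Fin 1) (hB.kRep ρK hinv) (hB.U ρ K (upqUnit ((0 : Fin 2), (0 : Fin 1)) (-I))) g ∘L
        hB.U ρ K (upqUnit ((0 : Fin 2), (0 : Fin 1)) (-I)) s := by
  have hbH := hB.lineBound_of_FB ρ hFB (upqUnit ((0 : Fin 2), (0 : Fin 1)) (-I))
  have hXH := hskew (upqUnit ((0 : Fin 2), (0 : Fin 1)) (-I))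
  have hU0 := hB.U_boostUnit_zero (0 : Fin 2) (0 : Fin 1) hK hskew hFB
  have hM := hB.kRep_comp_U_boostUnit_of_commute (0 : Fin 2) (0 : Fin 1) hV hinv hK hskew hFB
  have hW := hB.kRep_weyl_comp_U_boostUnit (0 : Fin 2) (0 : Fin 1) hV hinv hK hskew hFB
  have hϖu : ∀ k, hB.kRep ρK hinv k ∈ unitary (hB.E →L[ℂ] hB.E) := fun k => hB.kRep_mem_unitary ρK hinv k
  have hUu : ∀ t, hB.U ρ K (upqUnit ((0 : Fin 2), (0 : Fin 1)) (-I)) t ∈ unitary (hB.E →L[ℂ] hB.E) := fun t => hB.U_mem_unitary hK.le hXH hbH t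
  refine hB.eq_comp_U_of_hasDerivAt_inner (0 : Fin 2) (0 : Fin 1) hK hXH hbH _ (fun x => ?_) (fun x => ?_) g (fun s₀ hs₀ u w => ?_) s
  · exact ContinuousLinearMap.opNorm_le_bound _ zero_le_one fun y => by
      rw [ContinuousLinearMap.norm_map_of_mem_unitary (globOp_mem_unitary (0 : Fin 2) (0 : Fin 1) hU0 hM hW hϖu hUu x), one_mul]
  · exact continuous_globOp_apply (0 : Fin 2) (0 : Fin 1) hU0 hM hW hϖu hUu
      (hB.isStronglyContinuous_kRep ρK hinv hV.kFinite hV.weaklyContinuous) (fun v => hB.continuous_U_apply hK hXH hbH v) x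
  · obtain ⟨k₁, k₂, τ, Y₁, Y₁', Y₂, τ', hγ, -, hk₁', hY₁', hk₂, hτ, hE1⟩ := exists_section_along_hypV g hs₀
    exact hB.hasDerivAt_inner_globOp_mul_hypV (0 : Fin 2) (0 : Fin 1) uFormGroup_regular hV hinv hK hskew hFB hM hW g k₁ k₂ τ Y₁ Y₁' Y₂ τ'
      hγ hk₁' hY₁' hk₂ hτ hE1 u w

end IsPosDefHerm

end Literature.NumberTheory.Automorphic

end
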